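import Summits.ResolutionOfSingularities.ResolutionOfSingularities.Theorems.EquisingularLiftEquisingularLiftNatNDInitialFormMul
import Mathlib.Algebra.MvPolynomial.PDeriv
import HarnessLib

/-!
# [OURS · L1 W4.5(b) · EL♮(3)] DEAL «ND-K5», brick (B4γ) `ndInv_init` — sub-brick (γ5), part 2: a locally Newton-nondegenerate convenient germ
# has NO SQUARE FACTOR through the origin (`…NatNDLocalNDSquarefree`; WIDTH TABLE D1 row nose-w1, desk succession ruling 2026-08-28T14:56:41Z)

Cell `res-hironaka`, crux EL♮(3) `EquisingularLiftNatThree` (stmt-ResolutionOfSingularities-20148), chain W4.5b, line `sections`.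
res-L1-w45b-nose-w1 g0 (WIDTH seat; owner of (B4γ) `ND.ndInv_init` after res-type-027 g19's final cycle; the statement of the main theorem is
res-type-027 g19's typed signature from `L/res-type-027/g19/B4g-FEASIBILITY.md` sha16 1f63f2055c4d1e10, VERBATIM).  OURS; NOT a statement of any
manuscript; nothing of [Hironaka2017] is asserted; AI-written kernel algebra, weaker than expert review.  Def-free, `sorry`-free, standard axioms.
`--kind proof --supports stmt-ResolutionOfSingularities-20148 --as helper`.

WHY (B4γ) NEEDS IT.  `IsoHypNDWon k n H ι` (tree `…NatResidueHypDefsND`) offers a homogeneous `F ≠ 0` with `V₊(F) = ι(H)` AS A SET and, at every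
point `a` with `F(a) = ∇F(a) = 0`, a chart and origin-fixing coordinates in which the local equation of `F` is `LocalNDWon` (convenient + locally
Newton-nondegenerate + a won play).  `ND.NDInv` wants the STALK IDEAL of the reduced structure on `ι(H)` generated by that local equation, i.e. `F`
must be the REDUCED equation near the non-regular points.  Since `F = c·Gᵐ` with `G` the irreducible equation of the integral hypersurface `H`,
`m ≥ 2` would make the local equation a square times something — excluded by the main theorem below (`n ≥ 2`; for `n ≤ 1` the non-regular
locus is empty).

CONTENTS (namespace `…Cruxes.EquisingularLiftNat.Sections.ND`; part 1 `…NatNDInitialFormMul` supplies `initialForm_mul` and `exists_torus_zero`):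
* §1 WEIGHTS: `wt_linear`, `wt_one_add_bump`; `minimizer_of_forall_unique` (if every positive weight has a unique minimal exponent on a finite
  set `A`, the minimiser of one positive weight minimises all of them — else, moving along the segment between the two weights, the FIRST exponent
  to catch up ties at a positive integer combination: two minimisers) and ★ `exists_weight_two_minimizers` (`0 ∉ A` and every variable missed
  by some member of `A` ⇒ some positive integer weight has two minimal exponents on `A`).
* §2 ★★ `sq_dvd_false_of_localND (hn : 2 ≤ n) (hg : LocalND g) (hP : constantCoeff P = 0) (hdvd : P ^ 2 ∣ g) : False`.

References (mathematics): A. G. Kouchnirenko, *Polyèdres de Newton et nombres de Milnor*, Invent. Math. 32 (1976) 1–31, §1 (Newton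
non-degeneracy of the initial forms on compact faces); the weight argument is elementary linear programming (folklore).
-/

set_option linter.dupNamespace false

noncomputable section

open MvPolynomial

namespace Summit.ResolutionOfSingularities.ResolutionOfSingularities.Cruxes.EquisingularLiftNat.Sections.ND

open Summit.ResolutionOfSingularities.ResolutionOfSingularities.Cruxes.EquisingularLiftNat.Sections

variable {k : Type} [Field k] {N : ℕ}

/-! ## §1 Weights: linearity, and a positive weight with two minimal exponents -/

/-- The weight is linear in the weight vector. [OURS] -/
theorem wt_linear (s t : ℤ) (w₀ w : Fin N → ℤ) (d : Fin N →₀ ℕ) :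
    wt (fun i => s * w₀ i + t * w i) d = s * wt w₀ d + t * wt w d := by
  simp only [wt, add_mul, Finset.sum_add_distrib, Finset.mul_sum, mul_assoc]

/-- The weight for the all-ones vector bumped by `M` at the index `i`. [OURS] -/
theorem wt_one_add_bump (i : Fin N) (M : ℤ) (d : Fin N →₀ ℕ) :
    wt (fun j => 1 + if j = i then M else 0) d = wt (fun _ => (1 : ℤ)) d + M * (d i : ℤ) := by
  classical
  simp only [wt, add_mul, Finset.sum_add_distrib, one_mul, ite_mul, zero_mul, Finset.sum_ite_eq', Finset.mem_univ, if_true]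

/-- The all-ones weight of an exponent is non-negative. [OURS] -/
theorem wt_one_nonneg (d : Fin N →₀ ℕ) : 0 ≤ wt (fun _ => (1 : ℤ)) d := by
  simp only [wt, one_mul]
  exact Finset.sum_nonneg fun i _ => by exact_mod_cast Nat.zero_le _

/-- **Transfer of the unique minimiser.**  If EVERY positive weight has a unique minimal exponent on `A`, then the minimiser `a₀` of a
positive weight `w₀` minimises every other positive weight `w` too: otherwise, moving from `w₀` towards `w`, the FIRST exponent to catch
up with `a₀` (the one minimising `(⟨w₀,a⟩-⟨w₀,a₀⟩)/(⟨w,a₀⟩-⟨w,a⟩)` among those that beat `a₀` at `w`) ties with `a₀` at a positive integer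
combination of `w₀` and `w` — two minimisers. [OURS] -/
theorem minimizer_of_forall_unique {A : Finset (Fin N →₀ ℕ)}
    (huniq : ∀ w : Fin N → ℤ, (∀ i, 0 < w i) → ∀ a ∈ A, ∀ b ∈ A,
      (∀ c ∈ A, wt w a ≤ wt w c) → (∀ c ∈ A, wt w b ≤ wt w c) → a = b)
    {w₀ w : Fin N → ℤ} (hw₀ : ∀ i, 0 < w₀ i) (hw : ∀ i, 0 < w i) {a₀ : Fin N →₀ ℕ} (ha₀ : a₀ ∈ A)
    (hmin : ∀ c ∈ A, wt w₀ a₀ ≤ wt w₀ c) : ∀ c ∈ A, wt w a₀ ≤ wt w c := by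
  classical
  by_contra hcon
  push Not at hcon
  obtain ⟨c, hcA, hc⟩ := hcon
  -- the exponents beating `a₀` at `w`
  set B : Finset (Fin N →₀ ℕ) := A.filter fun a => wt w a < wt w a₀ with hB
  have hBne : B.Nonempty := ⟨c, Finset.mem_filter.mpr ⟨hcA, hc⟩⟩
  -- `α a ≥ 0`, `> 0` off `a₀`; `β a < 0` on `B`
  have hα : ∀ a ∈ A, 0 ≤ wt w₀ a - wt w₀ a₀ := fun a ha => sub_nonneg.mpr (hmin a ha)
  have hα' : ∀ a ∈ A, a ≠ a₀ → 0 < wt w₀ a - wt w₀ a₀ := by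
    intro a ha hne
    rcases (hα a ha).lt_or_eq with h | h
    · exact h
    · exfalso
      have hmin' : ∀ c ∈ A, wt w₀ a ≤ wt w₀ c := fun c hc' => by
        have := hmin c hc'; omega
      exact hne (huniq w₀ hw₀ a ha a₀ ha₀ hmin' hmin)
  -- the first exponent to catch up: minimise `α / (-β)` over `B`
  obtain ⟨a, haB, hamin⟩ := Finset.exists_min_image B
    (fun a => ((wt w₀ a - wt w₀ a₀ : ℤ) : ℚ) / ((wt w a₀ - wt w a : ℤ) : ℚ)) hBne
  have haA : a ∈ A := (Finset.mem_filter.mp haB).1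
  have hβa : wt w a < wt w a₀ := (Finset.mem_filter.mp haB).2
  have hane : a ≠ a₀ := fun h => by rw [h] at hβa; exact lt_irrefl _ hβa
  have hαa : 0 < wt w₀ a - wt w₀ a₀ := hα' a haA hane
  -- the tie weight `W := (-β a) • w₀ + (α a) • w`
  set s : ℤ := wt w a₀ - wt w a with hs
  set t : ℤ := wt w₀ a - wt w₀ a₀ with ht
  have hs0 : 0 < s := by omega
  let W : Fin N → ℤ := fun i => s * w₀ i + t * w i
  have hW : ∀ i, 0 < W i := fun i => by
    have := hw₀ i; have := hw i; show 0 < s * w₀ i + t * w i; positivity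
  have hWa₀ : ∀ c ∈ A, wt W a₀ ≤ wt W c := by
    intro c hcA'
    show wt (fun i => s * w₀ i + t * w i) a₀ ≤ wt (fun i => s * w₀ i + t * w i) c
    rw [wt_linear, wt_linear]
    by_cases hβc : wt w c < wt w a₀
    · -- `c ∈ B`: use the minimality of the ratio at `a`
      have hcB : c ∈ B := Finset.mem_filter.mpr ⟨hcA', hβc⟩
      have hrat := hamin c hcB
      have hden_a : (0 : ℚ) < ((wt w a₀ - wt w a : ℤ) : ℚ) := by exact_mod_cast hs0
      have hden_c : (0 : ℚ) < ((wt w a₀ - wt w c : ℤ) : ℚ) := by exact_mod_cast (show (0:ℤ) < wt w a₀ - wt w c by omega)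
      rw [div_le_div_iff₀ hden_a hden_c] at hrat
      have hrat' : (wt w₀ a - wt w₀ a₀) * (wt w a₀ - wt w c) ≤ (wt w₀ c - wt w₀ a₀) * (wt w a₀ - wt w a) := by
        exact_mod_cast hrat
      nlinarith
    · push Not at hβc
      have h1 : 0 ≤ wt w₀ c - wt w₀ a₀ := hα c hcA'
      nlinarith
  have hWa : ∀ c ∈ A, wt W a ≤ wt W c := by
    intro c hcA'
    have heq : wt W a = wt W a₀ := by
      show wt (fun i => s * w₀ i + t * w i) a = wt (fun i => s * w₀ i + t * w i) a₀
      rw [wt_linear, wt_linear, hs, ht]; ring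
    rw [heq]; exact hWa₀ c hcA'
  exact hane (huniq W hW a haA a₀ ha₀ hWa hWa₀)

/-- **A positive weight with two minimal exponents.**  If `A` is a non-empty finite set of exponents NOT containing `0`, and for every
variable `i` some member of `A` does not involve `tᵢ`, then some positive integer weight `w` has (at least) two distinct minimal
exponents on `A`.  (Otherwise all positive weights share ONE minimiser `a₀` by `minimizer_of_forall_unique`; testing with the weights
`𝟙 + M·eᵢ` against the member with `i`-th coordinate `0` gives `a₀ i = 0` for all `i`, i.e. `a₀ = 0 ∈ A`.) [OURS] -/
theorem exists_weight_two_minimizers {A : Finset (Fin N →₀ ℕ)} (hA : A.Nonempty) (h0 : (0 : Fin N →₀ ℕ) ∉ A)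
    (hax : ∀ i : Fin N, ∃ a ∈ A, a i = 0) :
    ∃ w : Fin N → ℤ, (∀ i, 0 < w i) ∧ ∃ a ∈ A, ∃ b ∈ A, a ≠ b ∧
      (∀ c ∈ A, wt w a ≤ wt w c) ∧ (∀ c ∈ A, wt w b ≤ wt w c) := by
  classical
  by_contra H
  have huniq : ∀ w : Fin N → ℤ, (∀ i, 0 < w i) → ∀ a ∈ A, ∀ b ∈ A,
      (∀ c ∈ A, wt w a ≤ wt w c) → (∀ c ∈ A, wt w b ≤ wt w c) → a = b := by
    intro w hw a ha b hb hamin hbmin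
    by_contra hne
    exact H ⟨w, hw, a, ha, b, hb, hne, hamin, hbmin⟩
  -- the common minimiser `a₀` (of the all-ones weight)
  obtain ⟨a₀, ha₀, hmin⟩ := Finset.exists_min_image A (wt fun _ => (1 : ℤ)) hA
  have hzero : ∀ i, a₀ i = 0 := by
    intro i
    obtain ⟨b, hb, hbi⟩ := hax i
    set M : ℤ := wt (fun _ => (1 : ℤ)) b + 1 with hM
    have hM0 : 0 < M := by have := wt_one_nonneg b; omega
    have hwpos : ∀ j, 0 < (1 + if j = i then M else 0 : ℤ) := fun j => by
      split_ifs <;> omega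
    have hle := minimizer_of_forall_unique huniq (fun _ => one_pos) hwpos ha₀ hmin b hb
    rw [wt_one_add_bump, wt_one_add_bump, hbi, Nat.cast_zero, mul_zero, add_zero] at hle
    have h1 := wt_one_nonneg a₀
    by_contra hne
    have hge : (1 : ℤ) ≤ (a₀ i : ℤ) := by exact_mod_cast Nat.one_le_iff_ne_zero.mpr hne
    nlinarith
  exact h0 (by rwa [show a₀ = 0 from Finsupp.ext hzero] at ha₀)


/-! ## §2 (γ5): a locally Newton-nondegenerate convenient germ has no square factor through the origin (`n ≥ 2`) -/

/-- **(γ5) `sq_dvd_false_of_localND`** — for `n ≥ 2` and `k` algebraically closed, a CONVENIENT, LOCALLY NEWTON-NONDEGENERATE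
`g ∈ k[t₁,…,tₙ]` (`LocalND g`) is not divisible by `P²` for any `P` with `P(0) = 0`.  Proof: convenience and `n ≥ 2` force every variable
to be missed by some monomial of `P` (a monomial `tⱼ^m` of `g = P²Q` is a sum of a monomial of `P` and one of `PQ`); with `P(0) = 0` this
gives a positive weight `w` with two `w`-minimal monomials of `P` (`exists_weight_two_minimizers`), so `in_w P` has a torus zero `x` over
`k̄` (`exists_torus_zero`); initial forms being multiplicative, `in_w g = (in_w P)²·in_w Q` vanishes at `x` together with all its partial
derivatives — contradicting `IsLocallyNewtonNondegenerate g` at `(w, x)`.  This is what pins the set-theoretic equation `F` of `IsoHypNDWon` to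
the REDUCED equation of `H` at the points of the non-regular locus in (B4γ) `ndInv_init`. [OURS · L1 W4.5b · (B4γ) sub-brick (γ5),
res-type-027 g19's typed signature] -/
theorem sq_dvd_false_of_localND {n : ℕ} (hn : 2 ≤ n) {k : Type} [Field k] [IsAlgClosed k] {g P : MvPolynomial (Fin n) k}
    (hg : LocalND g) (hP : constantCoeff P = 0) (hdvd : P ^ 2 ∣ g) : False := by
  classical
  obtain ⟨Q, hQ⟩ := hdvd
  have hg0 : g ≠ 0 := ne_zero_of_isLocallyND hg.2
  have hP0 : P ≠ 0 := by
    rintro rfl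
    exact hg0 (by rw [hQ, zero_pow two_ne_zero, zero_mul])
  have hPs : P.support.Nonempty := support_nonempty.mpr hP0
  -- (1) every variable is missed by some monomial of `P`
  have hax : ∀ i : Fin n, ∃ a ∈ P.support, a i = 0 := by
    intro i
    by_contra hcon
    push Not at hcon
    have h0n : 0 < n := by omega
    have h1n : 1 < n := by omega
    obtain ⟨j, hji⟩ : ∃ j : Fin n, j ≠ i := by
      by_cases hi : (i : ℕ) = 0
      · exact ⟨⟨1, h1n⟩, fun h => by simp [← h] at hi⟩
      · exact ⟨⟨0, h0n⟩, fun h => hi (by rw [← h])⟩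
    obtain ⟨m, -, hcoeff⟩ := hg.1.2 j
    have hmem : Finsupp.single j m ∈ g.support := mem_support_iff.mpr hcoeff
    rw [hQ, pow_two, mul_assoc] at hmem
    obtain ⟨a, ha, b, -, hab⟩ := Finset.mem_add.mp (support_mul P (P * Q) hmem)
    have hai : a i = 0 := by
      have := congrArg (fun f : Fin n →₀ ℕ => f i) hab
      simp only [Finsupp.add_apply, Finsupp.single_apply, if_neg hji] at this
      omega
    exact hcon a ha hai
  -- (2) `0 ∉ supp P`
  have h0 : (0 : Fin n →₀ ℕ) ∉ P.support := by
    rw [notMem_support_iff]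
    exact hP
  -- (3) a positive weight with two minimal monomials of `P`, both monomials of `in_w P`
  obtain ⟨w, hw, a, ha, b, hb, hab, hamin, hbmin⟩ := exists_weight_two_minimizers hPs h0 hax
  have hmin_eq : ∀ {c : Fin n →₀ ℕ}, c ∈ P.support → (∀ e ∈ P.support, wt w c ≤ wt w e) →
      wt w c = P.support.inf' hPs (wt w) := by
    intro c hc hcmin
    refine le_antisymm ?_ (inf'_le_wt w hPs hc)
    obtain ⟨e, he, heq⟩ := Finset.exists_mem_eq_inf' hPs (wt w)
    rw [heq]; exact hcmin e he
  have hmem : ∀ {c : Fin n →₀ ℕ}, c ∈ P.support → (∀ e ∈ P.support, wt w c ≤ wt w e) →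
      c ∈ (initialForm w P).support := by
    intro c hc hcmin
    rw [mem_support_iff, coeff_initialForm w hPs, if_pos (hmin_eq hc hcmin)]
    exact mem_support_iff.mp hc
  -- (4) a torus zero of `in_w P`
  obtain ⟨x, hx, hxP⟩ := exists_torus_zero (hmem ha hamin) (hmem hb hbmin) hab
  -- (5) `in_w g = in_w P · in_w P · in_w Q` is singular at `x`
  have hing : initialForm w g = initialForm w P * initialForm w P * initialForm w Q := by
    rw [hQ, pow_two, initialForm_mul, initialForm_mul]
  refine hg.2 w hw x hx ?_ ?_
  · rw [hing, map_mul, map_mul, hxP, mul_zero, zero_mul]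
  · intro i
    rw [hing, pderiv_mul, pderiv_mul]
    simp only [map_add, map_mul, hxP, mul_zero, zero_mul, add_zero]

end Summit.ResolutionOfSingularities.ResolutionOfSingularities.Cruxes.EquisingularLiftNat.Sections.ND

end
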